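import Mathlib
import Summits.Ventures.PercRepro.TriangleCapRegularCellFive

/-!
# PercRepro — THE REGULAR CELL `t = 6 D` ON `7 + (s − t)` VERTICES, EXACTLY: `{bottom, bottom + 5} ∪ [bottom + 8, bottom + 15 D]`
(p3, gen 55; part 308)

At `ℓ = 6` the row excess `Σ_{rows} k (6 − k)` is `0`, `10` or at least `16` (parts 290–291: the first gap `[1, 4]`, the
second gap `{6, 7}` in the units `j − bottom`) and at most `30 D` (`k (6 − k) ≤ 5 k`); conversely the value `5` is the
rows `(5, 1)` and every `8 ≤ m ≤ 15 D` is realised by BLOCKS of six edges — `(4,2)` (`8`), `(3,3)` (`9`), `(3,2,1)`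
(`11`), `(2,2,2)` (`12`), `(2,2,1,1)` (`13`), `(2,1,1,1,1)` (`14`), `(1^6)` (`15`) — and of twelve edges for `e = 10`
and `16 ≤ e ≤ 30`, with `m = 15 a + e`, `a = min(⌊(m − 8)/15⌋, D − 2)`, `e ∈ [8, 30]` (`rows_of_excess_six`; the
`min` keeps room for a twelve-edge block at the top).  THEOREM (`regular_cell_six`, `6 ≤ D`, `t = 6 D`, `2 t ≤ s`): `j`
is the band value of a triangle-free graph on `7 + (s − t)` vertices with `s` edges, a vertex of degree `s − t` and
every off-degree `≤ D` IFF `j = bottomReg 6 D`, `j = bottomReg 6 D + 5`, or `bottomReg 6 D + 8 ≤ j ≤ bottomReg 6 D + 15 D`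
(`bottomReg 6 D = 15 D (D − 1)`) — the g54 successor item (2) at `ℓ = 6`: the excess set misses exactly
`{1, 2, 3, 4, 6, 7}`.  Axioms: standard.
-/

namespace PercRepro

namespace TriangleCap

namespace C047

open Finset

/-- The entries of a list in `[1, 6]` give a sequence in `[1, 6]` below the length. -/
theorem getD_bounds_six (L : List ℕ) (hL : ∀ x ∈ L, 1 ≤ x ∧ x ≤ 6) (i : ℕ) (hi : i < L.length) :
    1 ≤ L.getD i 0 ∧ L.getD i 0 ≤ 6 := by
  rw [List.getD_eq_getElem L 0 hi]
  exact hL _ (List.getElem_mem hi)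

/-- The block of excess `e ∈ [8, 30]` (one or two row-groups of six edges each): its sizes. -/
def blockSix (e : ℕ) : List ℕ :=
  if e = 8 then [4, 2] else if e = 9 then [3, 3] else if e = 10 then [5, 1, 5, 1] else if e = 11 then [3, 2, 1]
  else if e = 12 then [2, 2, 2] else if e = 13 then [2, 2, 1, 1] else if e = 14 then [2, 1, 1, 1, 1]
  else if e = 15 then [1, 1, 1, 1, 1, 1] else if e = 16 then [4, 2, 4, 2] else if e = 17 then [4, 2, 3, 3]
  else if e = 18 then [3, 3, 3, 3] else if e = 19 then [4, 2, 3, 2, 1] else if e = 20 then [4, 2, 2, 2, 2]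
  else if e = 21 then [4, 2, 2, 2, 1, 1] else if e = 22 then [4, 2, 2, 1, 1, 1, 1]
  else if e = 23 then [4, 2, 1, 1, 1, 1, 1, 1] else if e = 24 then [3, 3, 1, 1, 1, 1, 1, 1]
  else if e = 25 then [3, 2, 1, 2, 1, 1, 1, 1] else if e = 26 then [2, 2, 2, 2, 1, 1, 1, 1]
  else if e = 27 then [2, 2, 2, 1, 1, 1, 1, 1, 1] else if e = 28 then [2, 2, 1, 1, 1, 1, 1, 1, 1, 1]
  else if e = 29 then [2, 1, 1, 1, 1, 1, 1, 1, 1, 1, 1] else [1, 1, 1, 1, 1, 1, 1, 1, 1, 1, 1, 1]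

/-- The facts about a block: its entries lie in `[1, 6]`, its sum is `6` or `12`, and its excess `Σ k (6 − k)` is `2 e`. -/
theorem blockSix_facts (e : ℕ) (he1 : 8 ≤ e) (he2 : e ≤ 30) :
    (∀ x ∈ blockSix e, 1 ≤ x ∧ x ≤ 6) ∧ ((blockSix e).sum = 6 ∨ (blockSix e).sum = 12) ∧
      ((blockSix e).map (fun k => k * (6 - k))).sum = 2 * e := by
  unfold blockSix
  interval_cases e <;> simp

/-- **THE ROWS OF EVERY EXCESS AT `ℓ = 6`:** for `m = 5` or `8 ≤ m ≤ 15 D` (`2 ≤ D`) there are row sizes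
`1 ≤ k i ≤ 6`, `i < N`, with `Σ k = 6 D` and `Σ k (6 − k) = 2 m`. -/
theorem rows_of_excess_six (D m : ℕ) (hD : 2 ≤ D) (hm : m = 5 ∨ (8 ≤ m ∧ m ≤ 15 * D)) :
    ∃ (N : ℕ) (k : ℕ → ℕ), (∀ i, i < N → 1 ≤ k i ∧ k i ≤ 6) ∧ ∑ i ∈ range N, k i = 6 * D ∧
      ∑ i ∈ range N, k i * (6 - k i) = 2 * m := by
  rcases hm with rfl | ⟨hm1, hm2⟩
  · -- the rows `(5, 1)` and `D − 1` full rows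
    set L := [5, 1] ++ List.replicate (D - 1) 6 with hL
    have hLmem : ∀ x ∈ L, 1 ≤ x ∧ x ≤ 6 := by
      intro x hx
      rw [hL, List.mem_append, List.mem_replicate] at hx
      rcases hx with hx | hx
      · simp only [List.mem_cons, List.not_mem_nil, or_false] at hx
        omega
      · omega
    refine ⟨L.length, fun i => L.getD i 0, fun i hi => getD_bounds_six L hLmem i hi, ?_, ?_⟩
    · rw [sum_range_getD L (fun x => x), hL, List.map_append, List.sum_append, List.map_id', List.map_id',
        List.sum_replicate]
      simp only [smul_eq_mul, List.sum_cons, List.sum_nil]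
      omega
    · rw [sum_range_getD L (fun k => k * (6 - k)), hL, List.map_append, List.sum_append, List.map_replicate,
        List.sum_replicate]
      simp
  · set a := min ((m - 8) / 15) (D - 2) with ha
    set e := m - 15 * a with he
    have he1 : 8 ≤ e := by omega
    have he2 : e ≤ 30 := by omega
    have haD : a + 2 ≤ D := by omega
    obtain ⟨hb1, hb2, hb5⟩ := blockSix_facts e he1 he2
    set B := blockSix e with hB
    set c := B.sum / 6 with hc
    have hc' : B.sum = 6 * c := by
      rcases hb2 with h | h <;> rw [h] at hc ⊢ <;> omega
    have hcD : a + c ≤ D := by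
      rcases hb2 with h | h <;> rw [h] at hc <;> omega
    set L := List.replicate (6 * a) 1 ++ B ++ List.replicate (D - a - c) 6 with hL
    have hLmem : ∀ x ∈ L, 1 ≤ x ∧ x ≤ 6 := by
      intro x hx
      rw [hL, List.mem_append, List.mem_append, List.mem_replicate, List.mem_replicate] at hx
      rcases hx with (hx | hx) | hx
      · omega
      · exact hb1 x hx
      · omega
    refine ⟨L.length, fun i => L.getD i 0, fun i hi => getD_bounds_six L hLmem i hi, ?_, ?_⟩
    · rw [sum_range_getD L (fun x => x), hL, List.map_append, List.map_append, List.sum_append, List.sum_append,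
        List.map_id', List.map_id', List.map_id', List.sum_replicate, List.sum_replicate, hc']
      simp only [smul_eq_mul]
      omega
    · rw [sum_range_getD L (fun k => k * (6 - k)), hL, List.map_append, List.map_append, List.sum_append,
        List.sum_append, List.map_replicate, List.map_replicate, List.sum_replicate, List.sum_replicate, hb5]
      simp only [smul_eq_mul]
      omega

/-- The excess of a row is at most five times its size: `k (6 − k) ≤ 5 k`. -/
theorem excess_le_five_mul (k : ℕ) : k * (6 - k) ≤ 5 * k := by
  rcases Nat.lt_or_ge k 6 with h | h
  · interval_cases k <;> omega
  · rw [Nat.sub_eq_zero_of_le h, mul_zero]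
    exact Nat.zero_le _

/-- **THE REGULAR CELL `t = 6 D`, EXACTLY:** for `6 ≤ D`, `t = 6 D`, `2 t ≤ s`, `j` is the band value of a
triangle-free graph on `7 + (s − t)` vertices with `s` edges, a vertex of degree `s − t` and every off-degree
`≤ D` IFF `j = bottomReg 6 D`, `j = bottomReg 6 D + 5`, or `bottomReg 6 D + 8 ≤ j ≤ bottomReg 6 D + 15 D`. -/
theorem regular_cell_six (s t D j : ℕ) (hD : 6 ≤ D) (ht : t = 6 * D) (hs : 2 * t ≤ s) :
    (∃ (H : SimpleGraph (Fin (6 + 1 + (s - t)))) (_ : DecidableRel H.Adj), H.CliqueFree 3 ∧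
      H.edgeFinset.card = s ∧ ∃ w, deg H w + t = s ∧ (∀ v, offDeg H w v ≤ D) ∧
        ∑ v, deg H v * deg H v + 2 * (t * (s - t - 1)) + 2 * j = s * (s + 1)) ↔
    (j = bottomReg 6 D ∨ j = bottomReg 6 D + 5 ∨ (bottomReg 6 D + 8 ≤ j ∧ j ≤ bottomReg 6 D + 15 * D)) := by
  subst ht
  have hb := two_mul_bottomReg 6 D (by norm_num) hD
  constructor
  · intro hj
    obtain ⟨N, k, hk, hsum, hid⟩ := (regular_cell_iff s (6 * D) 6 D j (by norm_num) hD rfl hs).mp hj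
    have hup : ∑ i ∈ range N, k i * (6 - k i) ≤ 30 * D := by
      calc ∑ i ∈ range N, k i * (6 - k i) ≤ ∑ i ∈ range N, 5 * k i := sum_le_sum (fun i _ => excess_le_five_mul (k i))
        _ = 5 * ∑ i ∈ range N, k i := by rw [mul_sum]
        _ = 30 * D := by rw [hsum]; ring
    rcases row_excess_trichotomy 6 D k N (by norm_num) (fun m hm => (hk m hm).1) (fun m hm => (hk m hm).2) hsum
      with h0 | h1 | h2
    · left
      omega
    · right
      left
      omega
    · right
      right
      omega
  · rintro (rfl | rfl | ⟨hlo, hhi⟩)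
    · exact ((regular_cell_first_gap s (6 * D) 6 D (by norm_num) hD rfl hs).2.1)
    · apply (regular_cell_iff s (6 * D) 6 D _ (by norm_num) hD rfl hs).mpr
      obtain ⟨N, k, hk, hsum, hex⟩ := rows_of_excess_six D 5 (by omega) (Or.inl rfl)
      refine ⟨N, k, hk, hsum, ?_⟩
      rw [hex]
      omega
    · apply (regular_cell_iff s (6 * D) 6 D j (by norm_num) hD rfl hs).mpr
      obtain ⟨N, k, hk, hsum, hex⟩ := rows_of_excess_six D (j - bottomReg 6 D) (by omega) (Or.inr ⟨by omega, by omega⟩)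
      refine ⟨N, k, hk, hsum, ?_⟩
      rw [hex]
      omega

end C047

end TriangleCap

end PercRepro
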